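import Literature.Geometry.Symplectic.SymplecticNormalFrameSmooth
import Literature.Geometry.Riemannian.ExpMapGlobalSmooth
import Literature.Geometry.Riemannian.MaximalGeodesicRescaling
import Literature.Geometry.Riemannian.ExpMapDifferential
import Literature.Geometry.Manifold.InverseFunctionTheorem
import HarnessLib

/-!
# The tubular map of a symplectic surface: `exp ∘ (realisation of ν_S)`

McDuff–Salamon, *Introduction to Symplectic Topology* (3rd ed. 2017), §3.4 p. 114 and Ex. 4.4.5:
a neighbourhood of a symplectic submanifold `Q` is modelled on a neighbourhood of the zero section
of its symplectic normal bundle `ν_Q ≅ TQ^ω`. This file constructs, for a symplectic surface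
`b : S → (N, s)` with the symplectic normal LINE bundle `ν = normalCore` of
`SymplecticSplittingIso.lean`, realised inside `TN` by `normalMap` (`SymplecticNormalRealization`),
and ANY connection `cov` on `TN` with `C¹`/`C^k` geodesic flow (e.g. the Levi-Civita connection
of a Riemannian metric), the **tubular map**

* `SymplecticSplitting.tubeMap … cov : E(ν) → N`, `v ↦ exp_{b y}(v · n_y)`,

and proves the tubular neighbourhood theorem for it in the form the self-intersection formula needs
(Lee, *Riemannian Manifolds* (2018), Thm. 5.25, proof; Hirsch, *Differential Topology*, Ch. 4 §5):

* `SymplecticSplitting.chartExp` — its expression `G(y, z) = exp_{b y}(z · ñ(y₀; y))` in the chart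
  of `ν` at `y₀` is `C^k` on an open domain containing (chart domain) × `{0}`
  (`contMDiffOn_chartExp`), with `G(y, 0) = b y` and differential
  `dG_{(y,0)}(w, ζ) = db_y w + ζ · ñ(y₀; y)` (`mfderiv_chartExp_zero_apply`), an isomorphism
  `T_yS × ℂ ≅ T_{b y}N = db(T_yS) ⊕ G_y` (`frameSumEquiv`); hence `G` is a local diffeomorphism at
  every point of the zero section (`isLocalDiffeomorphAt_chartExp`, inverse function theorem);
* `SymplecticSplitting.exists_nhds_zeroSection_injOn_isOpenMap` — `tubeMap` is a local
  homeomorphism at every point of the zero section;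
* `SymplecticSplitting.exists_isOpen_injOn_tubeMap` — **for compact `S` and injective `b` there is
  an open neighbourhood `𝒰` of the zero section on which `tubeMap` is injective and open**, i.e. a
  homeomorphism onto an open neighbourhood of `b(S)` mapping the zero section to `b`
  (injectivity near a compact set, `Set.InjOn.exists_isOpen_superset`).

Everything is proved; no named facts. Brick B1c of the self-intersection formula
`⟨c₁(ν_S), [S]⟩ = S·S` (McDuff–Salamon 2017, Ex. 4.4.5 / Thm. 2.7.5).

## References

* [McDuffSalamon2017] D. McDuff, D. Salamon, Introduction to Symplectic Topology, 3rd ed., OUP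
  2017, §3.4 p. 114, Ex. 4.4.5.
* [LeeRiemannianManifolds2018] J. M. Lee, Introduction to Riemannian Manifolds, 2nd ed., Springer
  GTM 176 (2018), Prop. 5.19, Thm. 5.25.
* [HirschDT1976] M. W. Hirsch, Differential Topology, Springer GTM 33 (1976), Ch. 4 §5, Ch. 2 §1 Ex. 7.
-/

noncomputable section

open scoped Manifold ContDiff Topology RealInnerProductSpace
open Function Module Set Bundle Literature.Geometry.Kaehler Literature.Geometry.Riemannian
  Literature.Geometry.Lorentzian Literature.Geometry.Manifold

namespace Literature.Geometry.Symplectic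

namespace SymplecticSplitting

variable {EN : Type*} [NormedAddCommGroup EN] [InnerProductSpace ℝ EN] [FiniteDimensional ℝ EN]
  [CompleteSpace EN] {HN : Type*} [TopologicalSpace HN] {IN : ModelWithCorners ℝ EN HN}
  {N : Type*} [TopologicalSpace N] [ChartedSpace HN N]
  {ES : Type*} [NormedAddCommGroup ES] [InnerProductSpace ℝ ES] [FiniteDimensional ℝ ES]
  [CompleteSpace ES] {HS : Type*} [TopologicalSpace HS] {IS : ModelWithCorners ℝ ES HS}
  {S : Type*} [TopologicalSpace S] [ChartedSpace HS S]
  [IsManifold IN ∞ N] [IsManifold IS ∞ S] {s : MForm IN N ℝ 2} (J : AlmostComplexStructure IN ∞ N)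
  {b : S → N}

/-! ### The chart field `(y, z) ↦ z · ñ(y₀; y)` -/

/-- **The chart field**: `(y, z) ↦ z · ñ(y₀; y) ∈ T_{b y}N`, the vector of the frame of index `y₀`
with complex coordinate `z` — the fibre component of `normalMap` read in the chart of `ν` at `y₀`
(`normalVector_eq_chartField`). [cite: McDuffSalamon2017, §3.4 p. 114] -/
def chartField (hbnd : ∀ y, PullbackNondegAt IS s b y) (hdim : finrank ℝ EN = finrank ℝ ES + 2)
    (y₀ : S) (q : S × ℂ) : EN :=
  lineVec (formAt s (b q.1)) (rawDeriv IN IS b q.1) (J.Jm (b q.1)) (rawFrame IS s b (seed hbnd hdim y₀) y₀ q.1) q.2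

variable {J} (hs : IsSmoothForm s)
  (hsnd : ∀ (x : N) (v : TangentSpace IN x), v ≠ 0 → ∃ w : TangentSpace IN x, s x ![v, w] ≠ 0)
  (hJt : J.IsTamedBy s) (hb : ContMDiff IS IN ∞ b) (hbnd : ∀ y, PullbackNondegAt IS s b y)
  (hdim : finrank ℝ EN = finrank ℝ ES + 2)

omit [IsManifold IS ∞ S] in
/-- The chart field vanishes on the zero section. [folklore] -/
@[simp]
theorem chartField_zero (y₀ y : S) : chartField J hbnd hdim y₀ (y, 0) = 0 := lineVec_zero _ _ _ _

omit [IsManifold IS ∞ S] in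
/-- The chart field is real-homogeneous in `z`. [folklore] -/
theorem chartField_real_smul (y₀ y : S) (c : ℝ) (z : ℂ) :
    chartField J hbnd hdim y₀ (y, (c : ℂ) * z) = c • chartField J hbnd hdim y₀ (y, z) :=
  lineVec_real_smul _ _ _ _ c z

/-- **The realisation map in the chart of `ν` at `y₀` is the chart field**: for `v` over the base
set of `y₀`, `v · n_y = z · ñ(y₀; y)` with `(y, z)` the chart coordinates of `v`. [folklore] -/
theorem normalVector_eq_chartField {y₀ : S} {v : (normalCore hs hsnd hJt hb hbnd hdim).TotalSpace}
    (hv : v.proj ∈ (normalCore hs hsnd hJt hb hbnd hdim).baseSet y₀) :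
    normalVector J hbnd hdim v.proj v.2 =
      chartField J hbnd hdim y₀ ((normalCore hs hsnd hJt hb hbnd hdim).localTriv y₀ v) := by
  have hwz : v.2 = (normalCore hs hsnd hJt hb hbnd hdim).coordChange y₀ v.proj v.proj
      ((normalCore hs hsnd hJt hb hbnd hdim).coordChange v.proj y₀ v.proj v.2) := by
    rw [(normalCore hs hsnd hJt hb hbnd hdim).coordChange_comp v.proj y₀ v.proj v.proj
        ⟨⟨(normalCore hs hsnd hJt hb hbnd hdim).mem_baseSet_at v.proj, hv⟩,
          (normalCore hs hsnd hJt hb hbnd hdim).mem_baseSet_at v.proj⟩,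
      (normalCore hs hsnd hJt hb hbnd hdim).coordChange_self v.proj v.proj
        ((normalCore hs hsnd hJt hb hbnd hdim).mem_baseSet_at v.proj)]
  conv_lhs => rw [hwz]
  exact normalVector_coordChange hs hsnd hJt hb hbnd hdim y₀ v.proj _

include hs hsnd hJt hb in
/-- **The chart field is a `C^∞` map into `TN`** on (chart domain of `y₀`) × `ℂ`: in the tangent
trivialisation at `b y₀` it is `z · (chart frame)` (`lineVec_transport`, `tangentEquiv_rawFrame`),
`C^∞` by `contMDiffOn_chartLineVec`. [folklore] -/
theorem contMDiffOn_totalSpaceMk_chartField (y₀ : S) :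
    ContMDiffOn (IS.prod 𝓘(ℝ, ℂ)) IN.tangent ∞
      (fun q : S × ℂ ↦ (TotalSpace.mk' EN (b q.1) (chartField J hbnd hdim y₀ q :) : TangentBundle IN N))
      (chartDomain IN IS b y₀ ×ˢ univ) := by
  set eN := trivializationAt EN (TangentSpace IN : N → Type _) (b y₀) with heN
  have hin : MapsTo (fun q : S × ℂ ↦ (TotalSpace.mk' EN (b q.1) (chartField J hbnd hdim y₀ q :) : TangentBundle IN N))
      (chartDomain IN IS b y₀ ×ˢ univ) eN.source := by
    intro q hq
    rw [eN.mem_source, heN, TangentBundle.trivializationAt_baseSet]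
    exact apply_mem_source_of_mem_chartDomain hq.1
  rw [ModelWithCorners.tangent, eN.contMDiffOn_iff hin]
  refine ⟨hb.contMDiffOn.comp contMDiffOn_fst fun q hq ↦ hq.1,
    (contMDiffOn_chartLineVec hs hsnd hJt hb hbnd (seed hbnd hdim y₀) y₀).congr fun q hq ↦ ?_⟩
  have hq1 : q.1 ∈ chartDomain IN IS b y₀ := hq.1
  change tangentEquiv (I := IN) (b y₀) (b q.1) (apply_mem_source_of_mem_chartDomain hq1)
      (chartField J hbnd hdim y₀ q) = _
  rw [chartField, lineVec_transport (nondeg_formAt hsnd (b q.1)) (hbnd q.1) (tame_Jm hJt (b q.1))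
      (tangentEquiv (I := IN) (b y₀) (b q.1) (apply_mem_source_of_mem_chartDomain hq1))
      (tangentEquiv (I := IS) y₀ q.1 (mem_source_of_mem_chartDomain hq1)),
    tangentEquiv_rawFrame s b hbnd _ hq1, ← chartForm_eq_formT s b hq1, ← chartDeriv_eq_injT b hq1,
    ← coordJ_eq_conjV J (apply_mem_source_of_mem_chartDomain hq1)]

include hs hsnd hJt hb in
/-- The chart field as a continuous map into `TN` on (chart domain) × `ℂ`. [folklore] -/
theorem continuousOn_totalSpaceMk_chartField (y₀ : S) :
    ContinuousOn (fun q : S × ℂ ↦ (TotalSpace.mk' EN (b q.1) (chartField J hbnd hdim y₀ q :) : TangentBundle IN N))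
      (chartDomain IN IS b y₀ ×ˢ univ) :=
  (contMDiffOn_totalSpaceMk_chartField hs hsnd hJt hb hbnd hdim y₀).continuousOn

/-- On the base set of `y₀` the frame vector `ñ(y₀; y)` is nonzero. [folklore] -/
theorem rawFrame_ne_zero_of_mem_baseSet {y₀ y : S} (hy : y ∈ (normalCore hs hsnd hJt hb hbnd hdim).baseSet y₀) :
    rawFrame IS s b (seed hbnd hdim y₀) y₀ y ≠ 0 := by
  rw [normalCore_baseSet] at hy
  exact hy.2

/-! ### The chart exponential `G(y, z) = exp_{b y}(z · ñ(y₀; y))` -/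

section ChartExp

variable [T2Space N] [BoundarylessManifold IN N]
  (cov : CovariantDerivative IN EN (TangentSpace IN : N → Type _))
  [CovariantDerivative.ContMDiffCovariantDerivative cov 1]

variable (J) in
/-- **The chart exponential** `G(y, z) := exp_{b y}(z · ñ(y₀; y))` — the tubular map read in the
chart of `ν` at `y₀`. [cite: LeeRiemannianManifolds2018, Thm. 5.25 (proof)] -/
def chartExp (y₀ : S) (q : S × ℂ) : N := expMap cov (b q.1) (chartField J hbnd hdim y₀ q :)

variable (J) in
/-- **The domain of the chart exponential**: chart domain of `y₀` in the first variable, and the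
geodesic of `z · ñ(y₀; y)` defined up to time `1`. [cite: LeeRiemannianManifolds2018, Prop. 5.19 (a)] -/
def chartExpDomain (y₀ : S) : Set (S × ℂ) :=
  {q | q.1 ∈ chartDomain IN IS b y₀ ∧ (1 : ℝ) ∈ maximalGeodesicDomain cov (b q.1) (chartField J hbnd hdim y₀ q :)}

variable {cov}

omit [IsManifold IS ∞ S] in
/-- `1 ∈ dom γ_{(x, 0)}`: the constant geodesic. [cite: LeeRiemannianManifolds2018, Prop. 5.19 (a)] -/
theorem one_mem_maximalGeodesicDomain_zero (x : N) : (1 : ℝ) ∈ maximalGeodesicDomain cov x (0 : TangentSpace IN x) := by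
  rw [mem_maximalGeodesicDomain_iff_smul_mem_expDomain x (0 : TangentSpace IN x) 1, smul_zero]
  exact zero_mem_expDomain (cov := cov) x

omit [IsManifold IS ∞ S] in
/-- **(chart domain) × {0} lies in the domain of the chart exponential.** [cite: LeeRiemannianManifolds2018, p. 133] -/
theorem mem_chartExpDomain_zero (y₀ : S) {y : S} (hy : y ∈ chartDomain IN IS b y₀) :
    (y, (0 : ℂ)) ∈ chartExpDomain J hbnd hdim cov y₀ := by
  refine ⟨hy, ?_⟩
  change (1 : ℝ) ∈ maximalGeodesicDomain cov (b y) (chartField J hbnd hdim y₀ (y, 0) :)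
  rw [chartField_zero]
  exact one_mem_maximalGeodesicDomain_zero (b y)

omit [IsManifold IS ∞ S] in
/-- **`G(y, 0) = b y`** (`exp_x 0 = x`). [cite: LeeRiemannianManifolds2018, Thm. 5.25 (proof)] -/
@[simp]
theorem chartExp_zero (y₀ y : S) : chartExp J hbnd hdim cov y₀ (y, 0) = b y := by
  rw [chartExp, chartField_zero]
  exact expMap_zero (cov := cov) (b y)

variable {k : ℕ∞} [CovariantDerivative.ContMDiffCovariantDerivative cov k]

include hs hsnd hJt hb in
/-- **The domain of the chart exponential is open** (the exponential domain `𝓔 ⊆ TN` is open,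
`isOpen_setOf_one_mem_maximalGeodesicDomain`, and the chart field is continuous into `TN`).
[cite: LeeRiemannianManifolds2018, Prop. 5.19 (a)] -/
theorem isOpen_chartExpDomain (hk : 1 ≤ k) (y₀ : S) : IsOpen (chartExpDomain J hbnd hdim cov y₀) := by
  have h := (continuousOn_totalSpaceMk_chartField hs hsnd hJt hb hbnd hdim y₀).isOpen_inter_preimage
    ((isOpen_chartDomain hb.continuous y₀).prod isOpen_univ)
    (isOpen_setOf_one_mem_maximalGeodesicDomain (cov := cov) hk)
  convert h using 1
  ext q
  simp only [chartExpDomain, mem_setOf_eq, mem_inter_iff, mem_prod, mem_univ, and_true, mem_preimage]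

include hs hsnd hJt hb in
/-- **The chart exponential is `C^k` on its domain** (`exp` is `C^k` on `𝓔`,
`contMDiffOn_expMap_totalSpace`, composed with the `C^∞` chart field).
[cite: LeeRiemannianManifolds2018, Prop. 5.19 (a) and Thm. 5.25 (proof)] -/
theorem contMDiffOn_chartExp (hk : 1 ≤ k) (y₀ : S) :
    ContMDiffOn (IS.prod 𝓘(ℝ, ℂ)) IN k (chartExp J hbnd hdim cov y₀) (chartExpDomain J hbnd hdim cov y₀) :=
  (contMDiffOn_expMap_totalSpace (cov := cov) hk).comp
    (((contMDiffOn_totalSpaceMk_chartField hs hsnd hJt hb hbnd hdim y₀).of_le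
      (by exact_mod_cast le_top)).mono fun q hq ↦ ⟨hq.1, mem_univ _⟩)
    fun q hq ↦ hq.2

include hs hsnd hJt hb in
/-- `G` is `C^k` at every point of its (open) domain. [cite: LeeRiemannianManifolds2018, Thm. 5.25 (proof)] -/
theorem contMDiffAt_chartExp (hk : 1 ≤ k) (y₀ : S) {q : S × ℂ} (hq : q ∈ chartExpDomain J hbnd hdim cov y₀) :
    ContMDiffAt (IS.prod 𝓘(ℝ, ℂ)) IN k (chartExp J hbnd hdim cov y₀) q :=
  (contMDiffOn_chartExp hs hsnd hJt hb hbnd hdim hk y₀).contMDiffAt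
    ((isOpen_chartExpDomain hs hsnd hJt hb hbnd hdim hk y₀).mem_nhds hq)

include hs hsnd hJt hb in
/-- The derivative of the fibre restriction `z ↦ G(y, z)` at `z = 0` is the frame map
`ζ ↦ ζ · ñ(y₀; y)` (`d(exp_x)_0 = id`: the velocity of `t ↦ exp_x(t v)` at `0` is `v`,
`velocity_expMap_smul_zero`, with the chain rule along lines `velocity_comp_lineAt_zero`).
[cite: LeeRiemannianManifolds2018, Prop. 5.19 (d)] -/
theorem mfderiv_chartExp_fibre_zero (hk : 1 ≤ k) (y₀ : S) {y : S} (hy : y ∈ chartDomain IN IS b y₀) (ζ : ℂ) :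
    mfderiv 𝓘(ℝ, ℂ) IN (fun z : ℂ ↦ chartExp J hbnd hdim cov y₀ (y, z)) 0 ζ = (chartField J hbnd hdim y₀ (y, ζ) :) := by
  have hk0 : ((k : ℕ∞ω)) ≠ 0 := by
    have : (1 : ℕ∞ω) ≤ k := by exact_mod_cast hk
    exact (lt_of_lt_of_le zero_lt_one this).ne'
  have hf : MDifferentiableAt 𝓘(ℝ, ℂ) IN (fun z : ℂ ↦ chartExp J hbnd hdim cov y₀ (y, z)) 0 := by
    have h1 : ContMDiffAt 𝓘(ℝ, ℂ) (IS.prod 𝓘(ℝ, ℂ)) k (fun z : ℂ ↦ ((y, z) : S × ℂ)) 0 :=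
      contMDiffAt_const.prodMk contMDiffAt_id
    exact ((contMDiffAt_chartExp hs hsnd hJt hb hbnd hdim hk y₀ (mem_chartExpDomain_zero hbnd hdim y₀ hy)).comp 0 h1).mdifferentiableAt hk0
  have h := velocity_comp_lineAt_zero (I := IN) (f := fun z : ℂ ↦ chartExp J hbnd hdim cov y₀ (y, z)) (a := 0) hf ζ
  rw [← h]
  have hfun : (fun t : ℝ ↦ chartExp J hbnd hdim cov y₀ (y, (0 : ℂ) + t • ζ)) =
      fun t : ℝ ↦ expMap cov (b y) (t • ((chartField J hbnd hdim y₀ (y, ζ) :) : TangentSpace IN (b y))) := by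
    funext t
    rw [zero_add, chartExp, Complex.real_smul, chartField_real_smul]
  rw [hfun]
  exact velocity_expMap_smul_zero (cov := cov) (b y) _

include hs hsnd hJt hb in
/-- **The differential of the chart exponential along the zero section**:
`dG_{(y,0)}(w, ζ) = db_y(w) + ζ · ñ(y₀; y)` — on (chart domain) × `{0}` the map is `b`, and on the
fibre `{y} × ℂ` it is `z ↦ exp_{b y}(z · ñ)` with derivative the frame map (Lee: "`dE_{(x,0)}` … on
the fiber `E` agrees with `exp_x`"; `mfderiv_prod_eq_add`). [cite: LeeRiemannianManifolds2018, Thm. 5.25 (proof)] -/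
theorem mfderiv_chartExp_zero_apply (hk : 1 ≤ k) (y₀ : S) {y : S} (hy : y ∈ chartDomain IN IS b y₀)
    (q : TangentSpace (IS.prod 𝓘(ℝ, ℂ)) (y, (0 : ℂ))) :
    mfderiv (IS.prod 𝓘(ℝ, ℂ)) IN (chartExp J hbnd hdim cov y₀) (y, 0) q =
      frameSum (rawDeriv IN IS b y) (rawFrame IS s b (seed hbnd hdim y₀) y₀ y)
        (adaptedJ (formAt s (b y)) (rawDeriv IN IS b y) (J.Jm (b y)) (rawFrame IS s b (seed hbnd hdim y₀) y₀ y)) q := by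
  have hk0 : ((k : ℕ∞ω)) ≠ 0 := by
    have : (1 : ℕ∞ω) ≤ k := by exact_mod_cast hk
    exact (lt_of_lt_of_le zero_lt_one this).ne'
  have hd : MDifferentiableAt (IS.prod 𝓘(ℝ, ℂ)) IN (chartExp J hbnd hdim cov y₀) (y, 0) :=
    (contMDiffAt_chartExp hs hsnd hJt hb hbnd hdim hk y₀ (mem_chartExpDomain_zero hbnd hdim y₀ hy)).mdifferentiableAt hk0
  rw [mfderiv_prod_eq_add_apply hd, frameSum_seed_apply]
  show mfderiv IS IN (fun y' : S ↦ chartExp J hbnd hdim cov y₀ (y', 0)) y q.1 +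
      mfderiv 𝓘(ℝ, ℂ) IN (fun z : ℂ ↦ chartExp J hbnd hdim cov y₀ (y, z)) 0 q.2 = _
  have hfun : (fun y' : S ↦ chartExp J hbnd hdim cov y₀ (y', 0)) = b := funext fun y' ↦ chartExp_zero hbnd hdim y₀ y'
  rw [hfun, mfderiv_chartExp_fibre_zero hs hsnd hJt hb hbnd hdim hk y₀ hy]
  rfl

/-- **The differential `dG_{(y,0)}` is the frame isomorphism `(w, ζ) ↦ db_y w + ζ · ñ(y₀; y)`**,
`T_yS × ℂ ≅ db(T_yS) ⊕ G_y = T_{b y}N` (`frameSumEquiv`), for `y` in the base set of `y₀`.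
[cite: McDuffSalamon2017, §2.1 Lemma 2.1.1] -/
theorem mfderiv_chartExp_zero_eq_frameSumEquiv (hk : 1 ≤ k) {y₀ y : S}
    (hy : y ∈ (normalCore hs hsnd hJt hb hbnd hdim).baseSet y₀) :
    mfderiv (IS.prod 𝓘(ℝ, ℂ)) IN (chartExp J hbnd hdim cov y₀) (y, 0) =
      (frameSumEquiv (a := formAt s (b y)) (hbnd y) hdim
        (rawFrame_mem s b hbnd (seed hbnd hdim y₀) y₀ y)
        (adaptedJ_mem_normalSpace (J := J.Jm (b y)) (nondeg_formAt hsnd (b y)) (hbnd y) (tame_Jm hJt (b y))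
          (rawFrame_mem s b hbnd (seed hbnd hdim y₀) y₀ y))
        (linearIndependent_pair (d := rawDeriv IN IS b y) (nondeg_formAt hsnd (b y)) (tame_Jm hJt (b y))
          (rawFrame_ne_zero_of_mem_baseSet hs hsnd hJt hb hbnd hdim hy)) : (ES × ℂ) →L[ℝ] EN) := by
  refine ContinuousLinearMap.ext fun q ↦ ?_
  rw [mfderiv_chartExp_zero_apply hs hsnd hJt hb hbnd hdim hk y₀
    (mem_chartDomain_of_mem_baseSet hs hsnd hJt hb hbnd hdim hy), coe_frameSumEquiv]
  rfl

variable [IN.Boundaryless] [IS.Boundaryless]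

/-- **The chart exponential is a `C^k` local diffeomorphism at every point of the zero section**
over the base set of `y₀` (inverse function theorem on manifolds, `isLocalDiffeomorphAt_of_mfderiv`,
with the invertible differential `mfderiv_chartExp_zero_eq_frameSumEquiv`).
[cite: LeeRiemannianManifolds2018, Thm. 5.25 (proof, first paragraph)] -/
theorem isLocalDiffeomorphAt_chartExp (hk : 1 ≤ k) {y₀ y : S}
    (hy : y ∈ (normalCore hs hsnd hJt hb hbnd hdim).baseSet y₀) :
    IsLocalDiffeomorphAt (IS.prod 𝓘(ℝ, ℂ)) IN k (chartExp J hbnd hdim cov y₀) (y, 0) := by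
  have hk0 : ((k : ℕ∞ω)) ≠ 0 := by
    have : (1 : ℕ∞ω) ≤ k := by exact_mod_cast hk
    exact (lt_of_lt_of_le zero_lt_one this).ne'
  exact isLocalDiffeomorphAt_of_mfderiv hk0 (isOpen_chartExpDomain hs hsnd hJt hb hbnd hdim hk y₀)
    (mem_chartExpDomain_zero hbnd hdim y₀ (mem_chartDomain_of_mem_baseSet hs hsnd hJt hb hbnd hdim hy))
    (contMDiffOn_chartExp hs hsnd hJt hb hbnd hdim hk y₀) _
    (mfderiv_chartExp_zero_eq_frameSumEquiv hs hsnd hJt hb hbnd hdim hk hy)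

end ChartExp

/-! ### The tubular map on `E(ν)` -/

section TubeMap

variable [T2Space N] [BoundarylessManifold IN N]
  (cov : CovariantDerivative IN EN (TangentSpace IN : N → Type _))
  [CovariantDerivative.ContMDiffCovariantDerivative cov 1]

/-- **The tubular map** `E(ν) → N`, `v ↦ exp_{b y}(v · n_y)` — the exponential map of the
connection `cov` composed with the realisation `normalMap : E(ν) → TN`.
[cite: McDuffSalamon2017, §3.4 p. 114] [cite: LeeRiemannianManifolds2018, Thm. 5.25] -/
def tubeMap (v : (normalCore hs hsnd hJt hb hbnd hdim).TotalSpace) : N :=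
  expMap cov (b v.proj) (normalVector J hbnd hdim v.proj v.2 :)

/-- **The domain of the tubular map**: the vectors whose geodesic is defined up to time `1`
(all of `E(ν)` for a complete connection). [cite: LeeRiemannianManifolds2018, Prop. 5.19 (a)] -/
def tubeDomain : Set (normalCore hs hsnd hJt hb hbnd hdim).TotalSpace :=
  {v | (1 : ℝ) ∈ maximalGeodesicDomain cov (b v.proj) (normalVector J hbnd hdim v.proj v.2 :)}

variable {cov}

/-- **The tubular map is `b` on the zero section.** [cite: LeeRiemannianManifolds2018, Thm. 5.25 (proof)] -/
@[simp]
theorem tubeMap_zeroSection (y : S) :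
    tubeMap hs hsnd hJt hb hbnd hdim cov (zeroSection ℂ (normalCore hs hsnd hJt hb hbnd hdim).Fiber y) = b y := by
  change expMap cov (b y) (normalVector J hbnd hdim y 0 :) = b y
  rw [normalVector_zero]
  exact expMap_zero (cov := cov) (b y)

/-- The zero section lies in the domain of the tubular map. [cite: LeeRiemannianManifolds2018, p. 133] -/
theorem zeroSection_mem_tubeDomain (y : S) :
    zeroSection ℂ (normalCore hs hsnd hJt hb hbnd hdim).Fiber y ∈ tubeDomain hs hsnd hJt hb hbnd hdim cov := by
  change (1 : ℝ) ∈ maximalGeodesicDomain cov (b y) (normalVector J hbnd hdim y 0 :)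
  rw [normalVector_zero]
  exact one_mem_maximalGeodesicDomain_zero (cov := cov) (b y)

omit [T2Space N] [BoundarylessManifold IN N] [CovariantDerivative.ContMDiffCovariantDerivative cov 1] in
/-- **The tubular map in the chart of `ν` at `y₀` is the chart exponential.** [folklore] -/
theorem tubeMap_eq_chartExp {y₀ : S} {v : (normalCore hs hsnd hJt hb hbnd hdim).TotalSpace}
    (hv : v.proj ∈ (normalCore hs hsnd hJt hb hbnd hdim).baseSet y₀) :
    tubeMap hs hsnd hJt hb hbnd hdim cov v =
      chartExp J hbnd hdim cov y₀ ((normalCore hs hsnd hJt hb hbnd hdim).localTriv y₀ v) := by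
  rw [tubeMap, normalVector_eq_chartField hs hsnd hJt hb hbnd hdim hv]
  rfl

omit [T2Space N] [BoundarylessManifold IN N] [CovariantDerivative.ContMDiffCovariantDerivative cov 1] in
/-- Membership in the tubular domain read in the chart at `y₀`. [folklore] -/
theorem mem_tubeDomain_iff_chart {y₀ : S} {v : (normalCore hs hsnd hJt hb hbnd hdim).TotalSpace}
    (hv : v.proj ∈ (normalCore hs hsnd hJt hb hbnd hdim).baseSet y₀) :
    v ∈ tubeDomain hs hsnd hJt hb hbnd hdim cov ↔
      (normalCore hs hsnd hJt hb hbnd hdim).localTriv y₀ v ∈ chartExpDomain J hbnd hdim cov y₀ := by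
  change (1 : ℝ) ∈ maximalGeodesicDomain cov (b v.proj) (normalVector J hbnd hdim v.proj v.2 :) ↔ _
  rw [normalVector_eq_chartField hs hsnd hJt hb hbnd hdim hv]
  exact ⟨fun h ↦ ⟨mem_chartDomain_of_mem_baseSet hs hsnd hJt hb hbnd hdim hv, h⟩, fun h ↦ h.2⟩

variable {k : ℕ∞} [CovariantDerivative.ContMDiffCovariantDerivative cov k]

/-- **The domain of the tubular map is open** (preimage of the open `𝓔 ⊆ TN` under the continuous
realisation map `normalMap`). [cite: LeeRiemannianManifolds2018, Prop. 5.19 (a)] -/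
theorem isOpen_tubeDomain (hk : 1 ≤ k) : IsOpen (tubeDomain hs hsnd hJt hb hbnd hdim cov) :=
  (isOpen_setOf_one_mem_maximalGeodesicDomain (cov := cov) hk).preimage
    (continuous_normalMap hs hsnd hJt hb hbnd hdim)

/-- **The tubular map is continuous on its domain.** [cite: LeeRiemannianManifolds2018, Prop. 5.19 (a)] -/
theorem continuousOn_tubeMap (hk : 1 ≤ k) :
    ContinuousOn (tubeMap hs hsnd hJt hb hbnd hdim cov) (tubeDomain hs hsnd hJt hb hbnd hdim cov) :=
  (contMDiffOn_expMap_totalSpace (cov := cov) hk).continuousOn.comp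
    (continuous_normalMap hs hsnd hJt hb hbnd hdim).continuousOn fun _ hv ↦ hv

variable [IN.Boundaryless] [IS.Boundaryless]

/-- **The tubular map is a local homeomorphism at every point of the zero section**: there is an
open `U ∋ 0_y` inside the domain on which `tubeMap` is injective and open (in the chart of `ν` at
`y` it is the local diffeomorphism `chartExp`, `isLocalDiffeomorphAt_chartExp`, composed with the
chart, a homeomorphism onto an open set). [cite: LeeRiemannianManifolds2018, Thm. 5.25 (proof)] -/
theorem exists_nhds_zeroSection_injOn_isOpenMap (hk : 1 ≤ k) (y : S) :
    ∃ U : Set (normalCore hs hsnd hJt hb hbnd hdim).TotalSpace, IsOpen U ∧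
      zeroSection ℂ (normalCore hs hsnd hJt hb hbnd hdim).Fiber y ∈ U ∧
      U ⊆ tubeDomain hs hsnd hJt hb hbnd hdim cov ∧
      InjOn (tubeMap hs hsnd hJt hb hbnd hdim cov) U ∧
      ∀ A ⊆ U, IsOpen A → IsOpen (tubeMap hs hsnd hJt hb hbnd hdim cov '' A) := by
  have hy : y ∈ (normalCore hs hsnd hJt hb hbnd hdim).baseSet y := (normalCore hs hsnd hJt hb hbnd hdim).mem_baseSet_at y
  obtain ⟨Φ, hΦ, heq⟩ := isLocalDiffeomorphAt_chartExp hs hsnd hJt hb hbnd hdim (cov := cov) hk hy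
  set e := ((normalCore hs hsnd hJt hb hbnd hdim).localTriv y).toOpenPartialHomeomorph with he
  set D := chartExpDomain J hbnd hdim cov y with hD
  have hDo : IsOpen D := isOpen_chartExpDomain hs hsnd hJt hb hbnd hdim hk y
  refine ⟨e.source ∩ e ⁻¹' (Φ.source ∩ D), e.continuousOn.isOpen_inter_preimage e.open_source
    (Φ.open_source.inter hDo), ?_, ?_, ?_, ?_⟩
  · -- the zero vector over `y` is sent to `(y, 0)`
    have h0 : e (zeroSection ℂ (normalCore hs hsnd hJt hb hbnd hdim).Fiber y) = (y, 0) :=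
      ((normalCore hs hsnd hJt hb hbnd hdim).localTriv y).zeroSection ℂ hy
    refine ⟨?_, ?_⟩
    · change zeroSection ℂ (normalCore hs hsnd hJt hb hbnd hdim).Fiber y ∈ ((normalCore hs hsnd hJt hb hbnd hdim).localTriv y).source
      rw [(normalCore hs hsnd hJt hb hbnd hdim).mem_localTriv_source]
      exact hy
    · rw [mem_preimage, h0]
      exact ⟨hΦ, mem_chartExpDomain_zero hbnd hdim y (mem_chartDomain_self b y)⟩
  · rintro v ⟨hv, -, hvD⟩
    have hvb : v.proj ∈ (normalCore hs hsnd hJt hb hbnd hdim).baseSet y :=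
      ((normalCore hs hsnd hJt hb hbnd hdim).mem_localTriv_source y v).1 hv
    exact (mem_tubeDomain_iff_chart hs hsnd hJt hb hbnd hdim hvb).2 hvD
  · rintro v ⟨hv, hvΦ, -⟩ v' ⟨hv', hv'Φ, -⟩ hvv
    have hvb : v.proj ∈ (normalCore hs hsnd hJt hb hbnd hdim).baseSet y :=
      ((normalCore hs hsnd hJt hb hbnd hdim).mem_localTriv_source y v).1 hv
    have hv'b : v'.proj ∈ (normalCore hs hsnd hJt hb hbnd hdim).baseSet y :=
      ((normalCore hs hsnd hJt hb hbnd hdim).mem_localTriv_source y v').1 hv'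
    have h1 : tubeMap hs hsnd hJt hb hbnd hdim cov v = Φ (e v) :=
      (tubeMap_eq_chartExp hs hsnd hJt hb hbnd hdim hvb).trans (heq hvΦ)
    have h2 : tubeMap hs hsnd hJt hb hbnd hdim cov v' = Φ (e v') :=
      (tubeMap_eq_chartExp hs hsnd hJt hb hbnd hdim hv'b).trans (heq hv'Φ)
    rw [h1, h2] at hvv
    exact e.injOn hv hv' (Φ.toOpenPartialHomeomorph.injOn hvΦ hv'Φ hvv)
  · intro A hA hAo
    have hAe : A ⊆ e.source := fun v hv ↦ (hA hv).1
    have h1 : IsOpen (e '' A) := e.isOpen_image_of_subset_source hAo hAe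
    have h2 : e '' A ⊆ Φ.source := by
      rintro _ ⟨v, hv, rfl⟩
      exact (hA hv).2.1
    have h3 : IsOpen (Φ.toOpenPartialHomeomorph '' (e '' A)) :=
      Φ.toOpenPartialHomeomorph.isOpen_image_of_subset_source h1 h2
    have h4 : tubeMap hs hsnd hJt hb hbnd hdim cov '' A = Φ.toOpenPartialHomeomorph '' (e '' A) := by
      rw [image_image]
      refine image_congr fun v hv ↦ ?_
      have hvb : v.proj ∈ (normalCore hs hsnd hJt hb hbnd hdim).baseSet y :=
        ((normalCore hs hsnd hJt hb hbnd hdim).mem_localTriv_source y v).1 (hA hv).1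
      exact (tubeMap_eq_chartExp hs hsnd hJt hb hbnd hdim hvb).trans (heq (hA hv).2.1)
    rw [h4]
    exact h3

/-- **Tubular neighbourhood theorem for a compact symplectic surface** (topological form): for
compact `S` and injective `b` there is an open neighbourhood `𝒰` of the zero section of `E(ν)`,
inside the domain, on which the tubular map `v ↦ exp_{b y}(v · n_y)` is injective and open — a
homeomorphism onto an open neighbourhood of `b(S)` in `N` sending the zero section to `b`
(injectivity near the compact zero section from injectivity on it and local injectivity,
`Set.InjOn.exists_isOpen_superset`; openness from the local homeomorphisms).
[cite: LeeRiemannianManifolds2018, Thm. 5.25] [cite: HirschDT1976, Ch. 4 §5 Thm. 5.1] -/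
theorem exists_isOpen_injOn_tubeMap [CompactSpace S] (hk : 1 ≤ k) (hbi : Injective b) :
    ∃ 𝒰 : Set (normalCore hs hsnd hJt hb hbnd hdim).TotalSpace, IsOpen 𝒰 ∧
      (∀ y, zeroSection ℂ (normalCore hs hsnd hJt hb hbnd hdim).Fiber y ∈ 𝒰) ∧
      𝒰 ⊆ tubeDomain hs hsnd hJt hb hbnd hdim cov ∧
      InjOn (tubeMap hs hsnd hJt hb hbnd hdim cov) 𝒰 ∧
      ∀ A ⊆ 𝒰, IsOpen A → IsOpen (tubeMap hs hsnd hJt hb hbnd hdim cov '' A) := by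
  choose U hUo hU0 hUD hUi hUopen using exists_nhds_zeroSection_injOn_isOpenMap hs hsnd hJt hb hbnd hdim (cov := cov) hk
  set K : Set (normalCore hs hsnd hJt hb hbnd hdim).TotalSpace := range (zeroSection ℂ (normalCore hs hsnd hJt hb hbnd hdim).Fiber) with hK
  have hKc : IsCompact K := isCompact_range
    (Trivialization.continuous_zeroSection (F := ℂ) (E := (normalCore hs hsnd hJt hb hbnd hdim).Fiber) ℂ)
  have hcont : ∀ v ∈ K, ContinuousAt (tubeMap hs hsnd hJt hb hbnd hdim cov) v := by
    rintro _ ⟨y, rfl⟩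
    exact (continuousOn_tubeMap hs hsnd hJt hb hbnd hdim hk).continuousAt
      ((isOpen_tubeDomain hs hsnd hJt hb hbnd hdim hk).mem_nhds (zeroSection_mem_tubeDomain hs hsnd hJt hb hbnd hdim y))
  have hinjK : InjOn (tubeMap hs hsnd hJt hb hbnd hdim cov) K := by
    rintro _ ⟨y, rfl⟩ _ ⟨y', rfl⟩ h
    rw [tubeMap_zeroSection, tubeMap_zeroSection] at h
    rw [hbi h]
  have hloc : ∀ v ∈ K, ∃ V ∈ 𝓝 v, InjOn (tubeMap hs hsnd hJt hb hbnd hdim cov) V := by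
    rintro _ ⟨y, rfl⟩
    exact ⟨U y, (hUo y).mem_nhds (hU0 y), hUi y⟩
  obtain ⟨O, hOo, hKO, hOi⟩ := hinjK.exists_isOpen_superset hKc hcont hloc
  refine ⟨O ∩ ⋃ y, U y, hOo.inter (isOpen_iUnion hUo), fun y ↦ ⟨hKO ⟨y, rfl⟩, mem_iUnion.2 ⟨y, hU0 y⟩⟩,
    fun v hv ↦ ?_, hOi.mono inter_subset_left, fun A hA hAo ↦ ?_⟩
  · obtain ⟨y, hy⟩ := mem_iUnion.1 hv.2
    exact hUD y hy
  · have hAeq : A = ⋃ y, A ∩ U y := by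
      ext v
      simp only [mem_iUnion, mem_inter_iff]
      exact ⟨fun hv ↦ (mem_iUnion.1 (hA hv).2).imp fun y hy ↦ ⟨hv, hy⟩, fun ⟨y, hv, _⟩ ↦ hv⟩
    rw [hAeq, image_iUnion]
    exact isOpen_iUnion fun y ↦ hUopen y _ inter_subset_right (hAo.inter (hUo y))

end TubeMap

end SymplecticSplitting

end Literature.Geometry.Symplectic

end
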